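import Literature.NumberTheory.DiophantineGeometry.AbcWave0
import HarnessLib

/-!
# The trivial upper bound for abc hits: `N(X) ≪_ε X ^ (2/3 + ε)` (abc.S28)

This companion file of `Literature.NumberTheory.DiophantineGeometry.AbcWave0` **discharges** the
named fact `Literature.NumberTheory.DiophantineGeometry.ABCHitCountUpperBound` (abc.S28, upper
bound): for every `ε > 0` there is `C` with `N(X) ≤ C · X ^ (2/3 + ε)` for all `X ≥ 2`, where
`N(X) = abcHitCount X` is the number of abc triples `a + b = c ≤ X` (positive, coprime) with
`rad(abc) < c`. No statement of `AbcWave0` is changed and no definition is introduced; this file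
only adds the proof (auxiliary lemmas in the sub-namespace `AbcHits`).

## Source and status of the statement

The inventory recorded the exponent `2/3` "from memory, to be checked at source". It is confirmed:
Bernert–Browning–Lichtman–Teräväinen, *Bounds on the exceptional set in the abc conjecture*
(arXiv:2410.12234, 2024), Proposition 1.1 (the "trivial bound"): for `λ > 0`,
`N_λ(X) = O_ε(X ^ (2λ/3 + ε))`, where `N_λ(X)` counts `(a, b, c) ∈ [1, X]³` with
`gcd(a, b, c) = 1`, `a + b = c`, `rad(abc) < c ^ λ`. For `λ = 1` this is literally `abcHitCount X`
(`gcd(a, b, c) = 1 ∧ a + b = c` iff `gcd(a, b) = 1`, and `c ≤ X` iff the triple lies in the box),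
so `ABCHitCountUpperBound` is Proposition 1.1 at `λ = 1`; their Theorem 1.2 improves the exponent
to `33/50` for `λ ∈ (0, 1.001)`.

## Proof (the sketch of [BernertEtAl2024, §1], made elementary)

For a hit, `a, b, c` are pairwise coprime, so `rad a · rad b · rad c = rad(abc) < c ≤ X`; hence the
two members `u, v` with the smallest radicals satisfy
`(rad u · rad v)³ ≤ (rad a · rad b · rad c)² < X²`, and the third member is recovered from `u, v`
and `a + b = c`. So `N(X) ≤ 3 · #{(u, v) ∈ [1, X]² : (rad u · rad v)³ < X²}`. Fibring over
`(r, s) = (rad u, rad v)`: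

* (`AbcHits.supportedCount_le_rankin`, Rankin's trick by a double induction, no infinite products)
  `#{k ≤ X : p ∣ k ⇒ p ∈ P} ≤ X ^ δ ∏_{p ∈ P} (1 − p ^ (−δ))⁻¹` for any finite set `P` of
  integers `≥ 2`;
* (`AbcHits.rankinFactor_primeFactors_le`) `∏_{p ∣ r} (1 − p ^ (−δ))⁻¹ ≤ K_δ r ^ δ`
  (a prime `p ≥ 2 ^ (1/δ)` contributes `≤ 2 ≤ p ^ δ`, a smaller one `≤ (1 − 2 ^ (−δ))⁻¹`);
* hence `#{u ≤ X : rad u = r} ≤ K_δ X ^ (2δ)` for `r ≤ X` (`AbcHits.card_radFibre_le`; this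
  replaces de Bruijn's estimate (1.1) of the source), and
* `#{(r, s) ∈ [1, X]² : (rs)³ < X²} ≤ ∑_{r ≤ X} X ^ (2/3) / r ≤ X ^ (2/3) (1 + log X)`
  (`AbcHits.card_hyperbolaPairs_le`, via `harmonic_le_one_add_log`), with `log X ≤ X ^ δ / δ`.

Altogether `N(X) ≤ 3 K_δ² (1 + 1/δ) X ^ (2/3 + 5δ)`; take `δ = ε / 5`.

## References

* [BernertEtAl2024] C. Bernert, T. Browning, J. D. Lichtman, J. Teräväinen, *Bounds on the
  exceptional set in the abc conjecture*, arXiv:2410.12234 (2024), Proposition 1.1, Theorem 1.2.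
* S. Dahmen, *Lower bounds for numbers of ABC-hits*, J. Number Theory 128 (2008) (the lower bound,
  `abcHitCount_lower_bound` in `AbcWave0`).
-/

noncomputable section

open UniqueFactorizationMonoid Finset

namespace Literature.NumberTheory.DiophantineGeometry

namespace AbcHits

/-! ### Integers with prescribed prime support: Rankin's bound

`#{k ∈ Icc 1 X | k.primeFactors ⊆ P}` is the number of `k ∈ [1, X]` all of whose prime factors
lie in `P`, and `∏ p ∈ P, (1 - (p : ℝ) ^ (-δ))⁻¹` is the Euler–Rankin factor of `P`. -/

/-- Nothing lies in `[1, 0]`. [folklore] -/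
theorem supportedCount_zero (P : Finset ℕ) : #{k ∈ Icc 1 0 | k.primeFactors ⊆ P} = 0 := by
  simp

/-- Only `k = 1` has no prime factor. [folklore] -/
theorem supportedCount_empty_le (X : ℕ) :
    #{k ∈ Icc 1 X | k.primeFactors ⊆ (∅ : Finset ℕ)} ≤ 1 := by
  calc #{k ∈ Icc 1 X | k.primeFactors ⊆ (∅ : Finset ℕ)} ≤ ({1} : Finset ℕ).card := by
        refine card_le_card (fun k hk => ?_)
        simp only [mem_filter, mem_Icc, Finset.subset_empty, Nat.primeFactors_eq_empty] at hk
        simp only [mem_singleton]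
        omega
    _ = 1 := card_singleton 1

/-- Splitting off one prime: a `P ∪ {p}`-supported `k ≤ X` is either `P`-supported or `p` times a
`P ∪ {p}`-supported integer `≤ X / p`. [folklore] -/
theorem supportedCount_insert_le (X : ℕ) (P : Finset ℕ) {p : ℕ} (hp : 0 < p) :
    #{k ∈ Icc 1 X | k.primeFactors ⊆ insert p P} ≤
      #{k ∈ Icc 1 X | k.primeFactors ⊆ P} +
        #{k ∈ Icc 1 (X / p) | k.primeFactors ⊆ insert p P} := by
  classical
  rw [← card_filter_add_card_filter_not (s := (Icc 1 X).filter
    (fun k : ℕ => k.primeFactors ⊆ insert p P)) (fun k => ¬ p ∣ k)]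
  refine add_le_add ?_ ?_
  · refine card_le_card (fun k hk => ?_)
    simp only [mem_filter] at hk ⊢
    obtain ⟨⟨hkI, hsub⟩, hndvd⟩ := hk
    refine ⟨hkI, fun q hq => ?_⟩
    rcases mem_insert.mp (hsub hq) with rfl | h
    · exact absurd (Nat.dvd_of_mem_primeFactors hq) hndvd
    · exact h
  · refine card_le_card_of_injOn (fun k => k / p) (fun k hk => ?_) (fun k hk k' hk' h => ?_)
    · simp only [coe_filter, mem_filter, mem_Icc, not_not, Set.mem_setOf_eq] at hk ⊢
      obtain ⟨⟨⟨hk1, hkX⟩, hsub⟩, hdvd⟩ := hk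
      refine ⟨⟨Nat.div_pos (Nat.le_of_dvd hk1 hdvd) hp, Nat.div_le_div_right hkX⟩, ?_⟩
      exact (Nat.primeFactors_mono (Nat.div_dvd_of_dvd hdvd) (by omega)).trans hsub
    · simp only [coe_filter, mem_filter, not_not, Set.mem_setOf_eq] at hk hk'
      have h' : k / p = k' / p := h
      calc k = k / p * p := (Nat.div_mul_cancel hk.2).symm
        _ = k' / p * p := by rw [h']
        _ = k' := Nat.div_mul_cancel hk'.2

/-- For `p ≥ 2` and `δ > 0` one has `0 < 1 - p ^ (-δ) ≤ 1`. [folklore] -/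
theorem rankin_term_pos {δ : ℝ} (hδ : 0 < δ) {p : ℕ} (hp : 2 ≤ p) :
    0 < 1 - (p : ℝ) ^ (-δ) ∧ 1 - (p : ℝ) ^ (-δ) ≤ 1 := by
  have hp1 : (1 : ℝ) < p := by exact_mod_cast hp
  have hlt : (p : ℝ) ^ (-δ) < 1 := Real.rpow_lt_one_of_one_lt_of_neg hp1 (by linarith)
  have hpos : 0 < (p : ℝ) ^ (-δ) := Real.rpow_pos_of_pos (by linarith) _
  constructor <;> linarith

/-- The Euler–Rankin factor of a set of integers `≥ 2` is positive. [folklore] -/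
theorem rankinFactor_pos {δ : ℝ} (hδ : 0 < δ) {P : Finset ℕ} (hP : ∀ p ∈ P, 2 ≤ p) :
    0 < ∏ p ∈ P, (1 - (p : ℝ) ^ (-δ))⁻¹ :=
  prod_pos fun p hp => inv_pos.mpr (rankin_term_pos hδ (hP p hp)).1

/-- **Rankin's bound.** For `δ > 0` and a finite set `P` of integers `≥ 2`, the number of
`k ∈ [1, X]` supported on `P` is at most `X ^ δ ∏_{p ∈ P} (1 - p ^ (-δ))⁻¹` (proved by induction
on `P` and, for the inserted `p`, strong induction on `X` via `supportedCount_insert_le`: the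
constants satisfy `C_P + p ^ (-δ) C_{P ∪ {p}} = C_{P ∪ {p}}`). [folklore] -/
theorem supportedCount_le_rankin {δ : ℝ} (hδ : 0 < δ) (P : Finset ℕ) (hP : ∀ p ∈ P, 2 ≤ p)
    (X : ℕ) :
    (#{k ∈ Icc 1 X | k.primeFactors ⊆ P} : ℝ) ≤ (X : ℝ) ^ δ * ∏ p ∈ P, (1 - (p : ℝ) ^ (-δ))⁻¹ := by
  classical
  induction P using Finset.induction_on generalizing X with
  | empty =>
    rcases Nat.eq_zero_or_pos X with rfl | hX
    · rw [supportedCount_zero, Nat.cast_zero, Real.zero_rpow hδ.ne', zero_mul]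
    · have h1 : (#{k ∈ Icc 1 X | k.primeFactors ⊆ (∅ : Finset ℕ)} : ℝ) ≤ 1 := by
        exact_mod_cast supportedCount_empty_le X
      have h2 : (1 : ℝ) ≤ (X : ℝ) ^ δ := Real.one_le_rpow (by exact_mod_cast hX) hδ.le
      simp only [prod_empty, mul_one]
      linarith
  | insert p P hpP ih =>
    have hp2 : 2 ≤ p := hP p (mem_insert_self p P)
    have hP' : ∀ q ∈ P, 2 ≤ q := fun q hq => hP q (mem_insert_of_mem hq)
    have hq := rankin_term_pos hδ hp2
    set q : ℝ := (p : ℝ) ^ (-δ) with hqdef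
    have hq0 : 0 ≤ q := (Real.rpow_pos_of_pos (by positivity) _).le
    set R : ℝ := ∏ p ∈ P, (1 - (p : ℝ) ^ (-δ))⁻¹ with hR
    have hRF : ∏ p' ∈ insert p P, (1 - (p' : ℝ) ^ (-δ))⁻¹ = (1 - q)⁻¹ * R := by
      rw [prod_insert hpP]
    rw [hRF]
    set R' : ℝ := (1 - q)⁻¹ * R with hR'
    have hR'pos : 0 < R' := mul_pos (inv_pos.mpr hq.1) (rankinFactor_pos hδ hP')
    have hRR' : R = (1 - q) * R' := by
      rw [hR', ← mul_assoc, mul_inv_cancel₀ hq.1.ne', one_mul]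
    induction X using Nat.strong_induction_on with
    | _ X ihX =>
      rcases Nat.eq_zero_or_pos X with rfl | hX
      · rw [supportedCount_zero, Nat.cast_zero]
        positivity
      have hlt : X / p < X := Nat.div_lt_self hX (by omega)
      have h1 := supportedCount_insert_le X P (p := p) (by omega)
      have hXp : ((X / p : ℕ) : ℝ) ^ δ ≤ (X : ℝ) ^ δ * q := by
        calc ((X / p : ℕ) : ℝ) ^ δ ≤ ((X : ℝ) / p) ^ δ :=
              Real.rpow_le_rpow (by positivity) (Nat.cast_div_le) hδ.le
          _ = (X : ℝ) ^ δ / (p : ℝ) ^ δ := Real.div_rpow (by positivity) (by positivity) δ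
          _ = (X : ℝ) ^ δ * q := by
              rw [hqdef, Real.rpow_neg (by positivity), div_eq_mul_inv]
      calc (#{k ∈ Icc 1 X | k.primeFactors ⊆ insert p P} : ℝ)
          ≤ #{k ∈ Icc 1 X | k.primeFactors ⊆ P} +
              #{k ∈ Icc 1 (X / p) | k.primeFactors ⊆ insert p P} := by exact_mod_cast h1
        _ ≤ (X : ℝ) ^ δ * R + ((X / p : ℕ) : ℝ) ^ δ * R' := add_le_add (ih hP' X) (ihX _ hlt)
        _ ≤ (X : ℝ) ^ δ * R + ((X : ℝ) ^ δ * q) * R' := by gcongr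
        _ = (X : ℝ) ^ δ * R' := by rw [hRR']; ring

/-! ### The Euler–Rankin factor over the primes of `r` is `≪ r ^ δ` -/

/-- Termwise bound at a prime `p ≥ 2`: with `T = 2 ^ (1/δ)` and `M = (1 - 2 ^ (-δ))⁻¹`,
`(1 - p ^ (-δ))⁻¹ ≤ M ^ [p < T] · p ^ δ` (for `p ≥ T`, `p ^ δ ≥ 2`, so the factor is `≤ 2 ≤ p ^ δ`;
for `p < T` it is `≤ M ≤ M p ^ δ`). [folklore] -/
theorem rankin_term_le {δ : ℝ} (hδ : 0 < δ) {p : ℕ} (hp : 2 ≤ p) :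
    (1 - (p : ℝ) ^ (-δ))⁻¹ ≤
      (if (p : ℝ) < (2 : ℝ) ^ (1 / δ) then (1 - (2 : ℝ) ^ (-δ))⁻¹ else 1) * (p : ℝ) ^ δ := by
  have hp0 : (0 : ℝ) < p := by positivity
  have hp1 : (1 : ℝ) ≤ p := by exact_mod_cast (by omega : 1 ≤ p)
  have h2 : 0 < 1 - (2 : ℝ) ^ (-δ) ∧ 1 - (2 : ℝ) ^ (-δ) ≤ 1 := by
    simpa using rankin_term_pos hδ (le_refl 2)
  have hpδ1 : 1 ≤ (p : ℝ) ^ δ := Real.one_le_rpow hp1 hδ.le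
  have hneg : (p : ℝ) ^ (-δ) = ((p : ℝ) ^ δ)⁻¹ := Real.rpow_neg hp0.le δ
  split_ifs with hT
  · have hmono : (p : ℝ) ^ (-δ) ≤ (2 : ℝ) ^ (-δ) :=
      Real.rpow_le_rpow_of_nonpos (by norm_num) (by exact_mod_cast hp) (by linarith)
    calc (1 - (p : ℝ) ^ (-δ))⁻¹ ≤ (1 - (2 : ℝ) ^ (-δ))⁻¹ := by
          apply inv_anti₀ h2.1
          linarith
      _ = (1 - (2 : ℝ) ^ (-δ))⁻¹ * 1 := (mul_one _).symm
      _ ≤ (1 - (2 : ℝ) ^ (-δ))⁻¹ * (p : ℝ) ^ δ :=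
          mul_le_mul_of_nonneg_left hpδ1 (inv_pos.mpr h2.1).le
  · rw [not_lt] at hT
    have hTδ : ((2 : ℝ) ^ (1 / δ)) ^ δ = 2 := by
      rw [← Real.rpow_mul (by norm_num), one_div, inv_mul_cancel₀ hδ.ne', Real.rpow_one]
    have hpδ2 : (2 : ℝ) ≤ (p : ℝ) ^ δ := by
      rw [← hTδ]
      exact Real.rpow_le_rpow (by positivity) hT hδ.le
    rw [one_mul, hneg]
    have hy : 0 < (p : ℝ) ^ δ := by positivity
    rw [inv_le_comm₀ (by rw [sub_pos, inv_lt_one_iff₀]; right; linarith) hy, le_sub_iff_add_le]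
    have : ((p : ℝ) ^ δ)⁻¹ ≤ 1 / 2 := by
      rw [one_div]; exact inv_anti₀ (by norm_num) hpδ2
    linarith

/-- **The Euler–Rankin factor is small.** For `δ > 0` there is `K > 0` with
`∏_{p ∣ r} (1 - p ^ (-δ))⁻¹ ≤ K r ^ δ` for every `r ≥ 1` (`K = M ^ ⌈T⌉₊` in the notation of
`rankin_term_le`, using `∏_{p ∣ r} p = rad r ≤ r`). [folklore] -/
theorem rankinFactor_primeFactors_le {δ : ℝ} (hδ : 0 < δ) :
    ∃ K : ℝ, 0 < K ∧ ∀ r : ℕ, 1 ≤ r →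
      ∏ p ∈ r.primeFactors, (1 - (p : ℝ) ^ (-δ))⁻¹ ≤ K * (r : ℝ) ^ δ := by
  set M : ℝ := (1 - (2 : ℝ) ^ (-δ))⁻¹ with hM
  set T : ℝ := (2 : ℝ) ^ (1 / δ) with hT
  have h2 : 0 < 1 - (2 : ℝ) ^ (-δ) ∧ 1 - (2 : ℝ) ^ (-δ) ≤ 1 := by
    simpa using rankin_term_pos hδ (le_refl 2)
  have hM1 : 1 ≤ M := one_le_inv_iff₀.mpr ⟨h2.1, h2.2⟩
  refine ⟨M ^ ⌈T⌉₊, by positivity, fun r hr => ?_⟩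
  have hr0 : r ≠ 0 := by omega
  have hle : ∏ p ∈ r.primeFactors, (1 - (p : ℝ) ^ (-δ))⁻¹ ≤
      ∏ p ∈ r.primeFactors, ((if (p : ℝ) < T then M else 1) * (p : ℝ) ^ δ) := by
    refine prod_le_prod (fun p hp => ?_) (fun p hp => ?_)
    · exact (inv_pos.mpr (rankin_term_pos hδ (Nat.prime_of_mem_primeFactors hp).two_le).1).le
    · exact rankin_term_le hδ (Nat.prime_of_mem_primeFactors hp).two_le
  refine hle.trans ?_
  rw [prod_mul_distrib, prod_ite, prod_const_one, mul_one, prod_const]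
  have hrad : ∏ p ∈ r.primeFactors, (p : ℝ) ^ δ = ((radical r : ℕ) : ℝ) ^ δ := by
    rw [Real.finsetProd_rpow _ _ (fun i _ => by positivity), Nat.radical_eq_prod_primeFactors]
    push_cast
    rfl
  rw [hrad]
  have hcard : (r.primeFactors.filter (fun p : ℕ => (p : ℝ) < T)).card ≤ ⌈T⌉₊ := by
    calc (r.primeFactors.filter (fun p : ℕ => (p : ℝ) < T)).card
        ≤ (Finset.range ⌈T⌉₊).card := by
          refine card_le_card (fun p hp => ?_)
          simp only [mem_filter] at hp
          exact mem_range.mpr (Nat.lt_ceil.mpr hp.2)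
      _ = ⌈T⌉₊ := card_range _
  have hradle : ((radical r : ℕ) : ℝ) ^ δ ≤ (r : ℝ) ^ δ := by
    apply Real.rpow_le_rpow (by positivity) ?_ hδ.le
    exact_mod_cast Nat.radical_le_self_iff.mpr hr0
  exact mul_le_mul (pow_le_pow_right₀ hM1 hcard) hradle (by positivity) (by positivity)

/-! ### Radical fibres `{u ∈ [1, X] : rad u = r}` are small -/

/-- `rad u = r` forces the prime factors of `u` to be those of `r`. [folklore] -/
theorem card_radFibre_le_supportedCount (X r : ℕ) :
    #{u ∈ Icc 1 X | radical u = r} ≤ #{k ∈ Icc 1 X | k.primeFactors ⊆ r.primeFactors} := by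
  refine card_le_card (fun u hu => ?_)
  simp only [mem_filter] at hu ⊢
  refine ⟨hu.1, ?_⟩
  rw [← hu.2, Nat.primeFactors_radical]

/-- **Radical fibres are small**: `#{u ≤ X : rad u = r} ≤ K_δ X ^ δ r ^ δ`. [folklore] -/
theorem card_radFibre_le {δ : ℝ} (hδ : 0 < δ) :
    ∃ K : ℝ, 0 < K ∧ ∀ X r : ℕ, 1 ≤ r →
      (#{u ∈ Icc 1 X | radical u = r} : ℝ) ≤ K * (X : ℝ) ^ δ * (r : ℝ) ^ δ := by
  obtain ⟨K, hK, hKr⟩ := rankinFactor_primeFactors_le hδ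
  refine ⟨K, hK, fun X r hr => ?_⟩
  have hP : ∀ p ∈ r.primeFactors, 2 ≤ p := fun p hp => (Nat.prime_of_mem_primeFactors hp).two_le
  have hX : (0 : ℝ) ≤ (X : ℝ) ^ δ := by positivity
  calc (#{u ∈ Icc 1 X | radical u = r} : ℝ)
      ≤ #{k ∈ Icc 1 X | k.primeFactors ⊆ r.primeFactors} := by
        exact_mod_cast card_radFibre_le_supportedCount X r
    _ ≤ (X : ℝ) ^ δ * ∏ p ∈ r.primeFactors, (1 - (p : ℝ) ^ (-δ))⁻¹ :=
        supportedCount_le_rankin hδ _ hP X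
    _ ≤ (X : ℝ) ^ δ * (K * (r : ℝ) ^ δ) := mul_le_mul_of_nonneg_left (hKr r hr) hX
    _ = K * (X : ℝ) ^ δ * (r : ℝ) ^ δ := by ring

/-! ### Pairs with small radical product, and the hyperbola count -/

/-- If `x, y ≤ z` then `(x y)³ ≤ (x y z)²`. [folklore] -/
theorem pow_three_le_sq_of_le {x y z : ℕ} (hx : x ≤ z) (hy : y ≤ z) :
    (x * y) ^ 3 ≤ (x * y * z) ^ 2 := by
  have h : x * y ≤ z * z := Nat.mul_le_mul hx hy
  calc (x * y) ^ 3 = (x * y) ^ 2 * (x * y) := by ring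
    _ ≤ (x * y) ^ 2 * (z * z) := Nat.mul_le_mul_left _ h
    _ = (x * y * z) ^ 2 := by ring

/-- For an abc hit `(a, b, c)` with `c ≤ X`, the two members with the smallest radicals form a pair
`(u, v) ∈ [1, X]²` with `(rad u · rad v)³ < X²` (pairwise coprimality gives
`rad a · rad b · rad c = rad(abc) < c ≤ X`). [folklore] -/
theorem hit_mem_smallRadPairs {X a b c : ℕ} {S : Finset (ℕ × ℕ)}
    (hS : {q ∈ Icc 1 X ×ˢ Icc 1 X | (radical q.1 * radical q.2) ^ 3 < X ^ 2} = S)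
    (ht : IsABCTriple a b c) (hcX : c ≤ X) (hrad : rad a b c < c) :
    (b, c) ∈ S ∨ (a, c) ∈ S ∨ (a, b) ∈ S := by
  subst hS
  obtain ⟨ha, hb, habc, hcop⟩ := ht
  have hac : Nat.Coprime a c := by rw [← habc]; exact Nat.coprime_self_add_right.mpr hcop
  have hbc : Nat.Coprime b c := by rw [← habc]; exact Nat.coprime_add_self_right.mpr hcop.symm
  have hprod : rad a b c = radical a * radical b * radical c := by
    rw [rad_def, radical_mul (Nat.coprime_iff_isRelPrime.mp
      (Nat.coprime_mul_iff_left.mpr ⟨hac, hbc⟩)), radical_mul (Nat.coprime_iff_isRelPrime.mp hcop)]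
  have hlt : radical a * radical b * radical c < X := by rw [← hprod]; omega
  have hsq : (radical a * radical b * radical c) ^ 2 < X ^ 2 :=
    Nat.pow_lt_pow_left hlt (by norm_num)
  have haI : a ∈ Icc 1 X := mem_Icc.mpr ⟨ha, by omega⟩
  have hbI : b ∈ Icc 1 X := mem_Icc.mpr ⟨hb, by omega⟩
  have hcI : c ∈ Icc 1 X := mem_Icc.mpr ⟨by omega, hcX⟩
  simp only [mem_filter, mem_product]
  rcases le_total (radical a) (radical b) with hab | hba
  · rcases le_total (radical b) (radical c) with hbc' | hcb
    · exact Or.inr (Or.inr ⟨⟨haI, hbI⟩,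
        lt_of_le_of_lt (pow_three_le_sq_of_le (hab.trans hbc') hbc') hsq⟩)
    · refine Or.inr (Or.inl ⟨⟨haI, hcI⟩, lt_of_le_of_lt ?_ hsq⟩)
      calc (radical a * radical c) ^ 3 ≤ (radical a * radical c * radical b) ^ 2 :=
            pow_three_le_sq_of_le hab hcb
        _ = (radical a * radical b * radical c) ^ 2 := by ring
  · rcases le_total (radical a) (radical c) with hac' | hca
    · exact Or.inr (Or.inr ⟨⟨haI, hbI⟩,
        lt_of_le_of_lt (pow_three_le_sq_of_le hac' (hba.trans hac')) hsq⟩)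
    · refine Or.inl ⟨⟨hbI, hcI⟩, lt_of_le_of_lt ?_ hsq⟩
      calc (radical b * radical c) ^ 3 ≤ (radical b * radical c * radical a) ^ 2 :=
            pow_three_le_sq_of_le hba hca
        _ = (radical a * radical b * radical c) ^ 2 := by ring

/-- **Three injections**: an abc hit is determined by any two of its members, so
`N(X) ≤ 3 · #{(u, v) ∈ [1, X]² : (rad u · rad v)³ < X²}`. [folklore] -/
theorem card_hits_le (X : ℕ) :
    (abcHits_finite X).toFinset.card ≤
      3 * #{q ∈ Icc 1 X ×ˢ Icc 1 X | (radical q.1 * radical q.2) ^ 3 < X ^ 2} := by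
  classical
  generalize hS : {q ∈ Icc 1 X ×ˢ Icc 1 X | (radical q.1 * radical q.2) ^ 3 < X ^ 2} = S
  set H := (abcHits_finite X).toFinset with hH
  have hmem : ∀ t ∈ H, IsABCTriple t.1 t.2.1 t.2.2 ∧ t.2.2 ≤ X ∧ rad t.1 t.2.1 t.2.2 < t.2.2 := by
    intro t ht
    simpa [hH, Set.Finite.mem_toFinset] using ht
  have hkey : ∀ t ∈ H, (t.2.1, t.2.2) ∈ S ∨ (t.1, t.2.2) ∈ S ∨ (t.1, t.2.1) ∈ S := by
    intro t ht
    obtain ⟨htr, hcX, hrad⟩ := hmem t ht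
    exact hit_mem_smallRadPairs hS htr hcX hrad
  -- an injection-on-hits bound, applied to the three coordinate projections
  have hbound : ∀ f : ℕ × ℕ × ℕ → ℕ × ℕ,
      (∀ t t' : ℕ × ℕ × ℕ, t.1 + t.2.1 = t.2.2 → t'.1 + t'.2.1 = t'.2.2 → f t = f t' → t = t') →
      (H.filter (fun t => f t ∈ S)).card ≤ S.card := by
    intro f hf
    refine card_le_card_of_injOn f (fun t ht => ?_) (fun t ht t' ht' h => ?_)
    · exact (mem_filter.mp (mem_coe.mp ht)).2
    · have h1 := (hmem t (mem_filter.mp (mem_coe.mp ht)).1).1.2.2.1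
      have h2 := (hmem t' (mem_filter.mp (mem_coe.mp ht')).1).1.2.2.1
      exact hf t t' h1 h2 h
  set f₁ : ℕ × ℕ × ℕ → ℕ × ℕ := fun t => (t.2.1, t.2.2) with hf₁
  set f₂ : ℕ × ℕ × ℕ → ℕ × ℕ := fun t => (t.1, t.2.2) with hf₂
  set f₃ : ℕ × ℕ × ℕ → ℕ × ℕ := fun t => (t.1, t.2.1) with hf₃
  have h₁ : (H.filter (fun t => f₁ t ∈ S)).card ≤ S.card := hbound f₁ (fun t t' h h' hf => by
    simp only [hf₁, Prod.mk.injEq] at hf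
    exact Prod.ext (by omega) (Prod.ext hf.1 hf.2))
  have h₂ : (H.filter (fun t => f₂ t ∈ S)).card ≤ S.card := hbound f₂ (fun t t' h h' hf => by
    simp only [hf₂, Prod.mk.injEq] at hf
    exact Prod.ext hf.1 (Prod.ext (by omega) hf.2))
  have h₃ : (H.filter (fun t => f₃ t ∈ S)).card ≤ S.card := hbound f₃ (fun t t' h h' hf => by
    simp only [hf₃, Prod.mk.injEq] at hf
    exact Prod.ext hf.1 (Prod.ext hf.2 (by omega)))
  have hcover : H ⊆ H.filter (fun t => f₁ t ∈ S) ∪ H.filter (fun t => f₂ t ∈ S) ∪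
      H.filter (fun t => f₃ t ∈ S) := by
    intro t ht
    rcases hkey t ht with h | h | h
    · exact mem_union_left _ (mem_union_left _ (mem_filter.mpr ⟨ht, h⟩))
    · exact mem_union_left _ (mem_union_right _ (mem_filter.mpr ⟨ht, h⟩))
    · exact mem_union_right _ (mem_filter.mpr ⟨ht, h⟩)
  have hunion := (card_le_card hcover).trans ((card_union_le _ _).trans
    (Nat.add_le_add_right (card_union_le _ _) _))
  omega

/-- Fibring the pairs `(u, v)` with `(rad u · rad v)³ < X²` over `(r, s) = (rad u, rad v)` (a point
under the hyperbola `(r s)³ < X²`): each fibre lies in a product of two radical fibres.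
[folklore] -/
theorem card_smallRadPairs_le (X : ℕ) :
    #{q ∈ Icc 1 X ×ˢ Icc 1 X | (radical q.1 * radical q.2) ^ 3 < X ^ 2} ≤
      ∑ q ∈ {q ∈ Icc 1 X ×ˢ Icc 1 X | (q.1 * q.2) ^ 3 < X ^ 2},
        #{u ∈ Icc 1 X | radical u = q.1} * #{u ∈ Icc 1 X | radical u = q.2} := by
  classical
  have hmaps : Set.MapsTo (fun q : ℕ × ℕ => (radical q.1, radical q.2))
      ({q ∈ Icc 1 X ×ˢ Icc 1 X | (radical q.1 * radical q.2) ^ 3 < X ^ 2} : Finset (ℕ × ℕ))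
      ({q ∈ Icc 1 X ×ˢ Icc 1 X | (q.1 * q.2) ^ 3 < X ^ 2} : Finset (ℕ × ℕ)) := by
    intro q hq
    obtain ⟨hqI, hlt⟩ := mem_filter.mp (mem_coe.mp hq)
    rw [mem_product, mem_Icc, mem_Icc] at hqI
    obtain ⟨⟨h1, h1X⟩, ⟨h2, h2X⟩⟩ := hqI
    refine mem_coe.mpr (mem_filter.mpr ⟨mem_product.mpr ⟨mem_Icc.mpr ⟨?_, ?_⟩,
      mem_Icc.mpr ⟨?_, ?_⟩⟩, hlt⟩)
    · exact Nat.succ_le_of_lt (Nat.radical_pos _)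
    · exact (Nat.radical_le_self_iff.mpr (by omega)).trans h1X
    · exact Nat.succ_le_of_lt (Nat.radical_pos _)
    · exact (Nat.radical_le_self_iff.mpr (by omega)).trans h2X
  rw [card_eq_sum_card_fiberwise hmaps]
  refine sum_le_sum (fun q _ => ?_)
  obtain ⟨r, s⟩ := q
  rw [← card_product]
  refine card_le_card (fun u hu => ?_)
  simp only [mem_filter, mem_product, Prod.mk.injEq] at hu ⊢
  obtain ⟨⟨⟨hu1, hu2⟩, -⟩, hr, hs⟩ := hu
  exact ⟨⟨hu1, hr⟩, ⟨hu2, hs⟩⟩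

/-- **Hyperbola count**: `#{(r, s) ∈ [1, X]² : (rs)³ < X²} ≤ X ^ (2/3) (1 + log X)`, summing
`#{s : s < X ^ (2/3) / r} ≤ X ^ (2/3) / r` over `r ≤ X` with `harmonic_le_one_add_log`.
[folklore] -/
theorem card_hyperbolaPairs_le (X : ℕ) :
    (#{q ∈ Icc 1 X ×ˢ Icc 1 X | (q.1 * q.2) ^ 3 < X ^ 2} : ℝ) ≤
      (X : ℝ) ^ (2 / 3 : ℝ) * (1 + Real.log X) := by
  classical
  generalize hT : {q ∈ Icc 1 X ×ˢ Icc 1 X | (q.1 * q.2) ^ 3 < X ^ 2} = T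
  set Y : ℝ := (X : ℝ) ^ (2 / 3 : ℝ) with hY
  have hY0 : 0 ≤ Y := by positivity
  have hY3 : Y ^ (3 : ℕ) = (X : ℝ) ^ 2 := by
    rw [hY, ← Real.rpow_natCast, ← Real.rpow_mul (by positivity)]
    norm_num
  have hmemT : ∀ q ∈ T, q.2 ∈ Icc 1 X ∧ (q.1 * q.2) ^ 3 < X ^ 2 := by
    intro q hq
    rw [← hT] at hq
    obtain ⟨hqI, hlt⟩ := mem_filter.mp hq
    exact ⟨(mem_product.mp hqI).2, hlt⟩
  have hmaps : Set.MapsTo (Prod.fst : ℕ × ℕ → ℕ) (T : Set (ℕ × ℕ)) (Icc 1 X : Set ℕ) := by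
    intro q hq
    rw [mem_coe, ← hT] at hq
    exact mem_coe.mpr (mem_product.mp (mem_filter.mp hq).1).1
  rw [card_eq_sum_card_fiberwise hmaps]
  push_cast
  have hfib : ∀ r ∈ Icc 1 X, ((T.filter (fun q => q.1 = r)).card : ℝ) ≤ Y / r := by
    intro r hr
    obtain ⟨hr1, -⟩ := mem_Icc.mp hr
    have hr0 : (0 : ℝ) < r := by exact_mod_cast hr1
    have hcard : (T.filter (fun q => q.1 = r)).card ≤ (Icc 1 ⌊Y / r⌋₊).card := by
      refine card_le_card_of_injOn Prod.snd (fun q hq => ?_) (fun q hq q' hq' h => ?_)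
      · obtain ⟨hqT, hq1⟩ := mem_filter.mp (mem_coe.mp hq)
        obtain ⟨hs, hlt⟩ := hmemT q hqT
        refine mem_coe.mpr (mem_Icc.mpr ⟨(mem_Icc.mp hs).1, Nat.le_floor ?_⟩)
        rw [le_div_iff₀ hr0]
        have h3 : ((q.1 * q.2 : ℕ) : ℝ) ^ 3 < Y ^ 3 := by
          rw [hY3]; exact_mod_cast hlt
        have hlt' : ((q.1 * q.2 : ℕ) : ℝ) < Y := lt_of_pow_lt_pow_left₀ 3 hY0 h3
        rw [hq1] at hlt'
        push_cast at hlt'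
        linarith
      · exact Prod.ext ((mem_filter.mp (mem_coe.mp hq)).2.trans
          (mem_filter.mp (mem_coe.mp hq')).2.symm) h
    have hcard' : (T.filter (fun q => q.1 = r)).card ≤ ⌊Y / r⌋₊ := by
      simpa [Nat.card_Icc] using hcard
    calc ((T.filter (fun q => q.1 = r)).card : ℝ) ≤ (⌊Y / r⌋₊ : ℝ) := by exact_mod_cast hcard'
      _ ≤ Y / r := Nat.floor_le (by positivity)
  calc ∑ r ∈ Icc 1 X, ((T.filter (fun q => q.1 = r)).card : ℝ)
      ≤ ∑ r ∈ Icc 1 X, Y / r := sum_le_sum hfib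
    _ = Y * ∑ r ∈ Icc 1 X, ((r : ℝ))⁻¹ := by rw [mul_sum]; rfl
    _ = Y * (harmonic X : ℝ) := by rw [harmonic_eq_sum_Icc]; push_cast; rfl
    _ ≤ Y * (1 + Real.log X) := mul_le_mul_of_nonneg_left (harmonic_le_one_add_log X) hY0

end AbcHits

open AbcHits in
/-- **abc.S28, upper bound — discharge of `ABCHitCountUpperBound`.** For every `ε > 0` there is
`C` such that the number `N(X)` of abc hits `a + b = c ≤ X`, `rad(abc) < c`, satisfies
`N(X) ≤ C · X ^ (2/3 + ε)` for all `X ≥ 2`. This is the "trivial bound"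
`N_λ(X) = O_ε(X ^ (2λ/3 + ε))` of Bernert–Browning–Lichtman–Teräväinen at `λ = 1` (their `N_1(X)`
is `abcHitCount X`); the proof is the one sketched there (two smallest radicals, then counting
integers with prescribed radical), carried out with Rankin's trick in place of de Bruijn's
estimate: `N(X) ≤ 3 K² (1 + 5/ε) X ^ (2/3 + ε)` with `K = K_{ε/5}` from
`AbcHits.card_radFibre_le`. [cite: BernertEtAl2024, Proposition 1.1] -/
theorem ABCHitCountUpperBound_holds : ABCHitCountUpperBound := by
  intro ε hε
  set δ : ℝ := ε / 5 with hδdef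
  have hδ : 0 < δ := by positivity
  obtain ⟨K, hK, hfib⟩ := card_radFibre_le hδ
  refine ⟨3 * (K ^ 2 * (1 + 1 / δ)), fun X hX => ?_⟩
  have hX0 : (0 : ℝ) < X := by exact_mod_cast (by omega : 0 < X)
  have hX1 : (1 : ℝ) ≤ X := by exact_mod_cast (by omega : 1 ≤ X)
  set E : ℝ := (X : ℝ) ^ δ with hE
  have hE1 : 1 ≤ E := Real.one_le_rpow hX1 hδ.le
  set Y : ℝ := (X : ℝ) ^ (2 / 3 : ℝ) with hY
  have hY0 : 0 ≤ Y := by positivity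
  -- radical fibres over `r ≤ X` have at most `K E²` elements
  have hfibX : ∀ r : ℕ, 1 ≤ r → r ≤ X → (#{u ∈ Icc 1 X | radical u = r} : ℝ) ≤ K * E * E := by
    intro r hr hrX
    have hrδ : (r : ℝ) ^ δ ≤ E :=
      Real.rpow_le_rpow (by positivity) (by exact_mod_cast hrX) hδ.le
    calc (#{u ∈ Icc 1 X | radical u = r} : ℝ) ≤ K * (X : ℝ) ^ δ * (r : ℝ) ^ δ := hfib X r hr
      _ ≤ K * E * E := mul_le_mul_of_nonneg_left hrδ (by positivity)
  -- the pairs with small radical product and the points under the hyperbola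
  generalize hS : {q ∈ Icc 1 X ×ˢ Icc 1 X | (radical q.1 * radical q.2) ^ 3 < X ^ 2} = S
  generalize hT : {q ∈ Icc 1 X ×ˢ Icc 1 X | (q.1 * q.2) ^ 3 < X ^ 2} = T
  have h1 : (abcHitCount X : ℝ) ≤ 3 * S.card := by
    rw [abcHitCount, Set.ncard_eq_toFinset_card _ (abcHits_finite X), ← hS]
    exact_mod_cast card_hits_le X
  have h2 : (S.card : ℝ) ≤ T.card * (K * E * E) ^ 2 := by
    calc (S.card : ℝ)
        ≤ ((∑ q ∈ T, #{u ∈ Icc 1 X | radical u = q.1} * #{u ∈ Icc 1 X | radical u = q.2} : ℕ)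
            : ℝ) := by
          rw [← hS, ← hT]; exact_mod_cast card_smallRadPairs_le X
      _ = ∑ q ∈ T, (#{u ∈ Icc 1 X | radical u = q.1} : ℝ) * #{u ∈ Icc 1 X | radical u = q.2} := by
          push_cast; rfl
      _ ≤ ∑ q ∈ T, (K * E * E) ^ 2 := by
          refine sum_le_sum (fun q hq => ?_)
          rw [← hT] at hq
          obtain ⟨hqI, -⟩ := mem_filter.mp hq
          rw [mem_product, mem_Icc, mem_Icc] at hqI
          obtain ⟨⟨h1r, hrX⟩, ⟨h1s, hsX⟩⟩ := hqI
          rw [sq]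
          exact mul_le_mul (hfibX _ h1r hrX) (hfibX _ h1s hsX) (by positivity) (by positivity)
      _ = T.card * (K * E * E) ^ 2 := by rw [sum_const, nsmul_eq_mul]
  have h3 : (T.card : ℝ) ≤ Y * (1 + Real.log X) := by
    rw [← hT]; exact card_hyperbolaPairs_le X
  have h4 : 1 + Real.log X ≤ (1 + 1 / δ) * E := by
    have hlog : Real.log X ≤ E / δ := Real.log_le_rpow_div hX0.le hδ
    calc 1 + Real.log X ≤ E + E / δ := add_le_add hE1 hlog
      _ = (1 + 1 / δ) * E := by ring
  have hE5 : Y * E ^ 5 = (X : ℝ) ^ (2 / 3 + ε : ℝ) := by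
    rw [hY, hE, ← Real.rpow_natCast, ← Real.rpow_mul hX0.le, ← Real.rpow_add hX0]
    congr 1
    rw [hδdef]; push_cast; ring
  calc (abcHitCount X : ℝ) ≤ 3 * S.card := h1
    _ ≤ 3 * (T.card * (K * E * E) ^ 2) := by gcongr
    _ ≤ 3 * ((Y * (1 + Real.log X)) * (K * E * E) ^ 2) := by gcongr
    _ ≤ 3 * ((Y * ((1 + 1 / δ) * E)) * (K * E * E) ^ 2) := by gcongr
    _ = 3 * (K ^ 2 * (1 + 1 / δ)) * (Y * E ^ 5) := by ring
    _ = 3 * (K ^ 2 * (1 + 1 / δ)) * (X : ℝ) ^ (2 / 3 + ε : ℝ) := by rw [hE5]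

end Literature.NumberTheory.DiophantineGeometry
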